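import Literature.NumberTheory.Weil1964.ArchGaussianFourier
import HarnessLib

/-!
# Folland's Theorem (4.37) PROVED: the metaplectic double cover `1 → {±1} → Mp₂(W) → Sp(W) → 1` (records R1, R2 discharged)

Topic `NumberTheory/Weil1964`; namespace `Literature.NumberTheory.Weil1964`.  KERNEL throughout: one Prop-valued definition
with body and proved theorems — no records, no `sorry`, no cited hypothesis.  NET DEBT −2: this file proves the two cited
records `Folland1989_Thm_4_37_ab` (R1) and `Folland1989_Thm_4_37_c` (R2) of `ArchMetaplecticDoubleCover`, hence its target
`Folland1989_metaplectic_doubleValued` (N-W∞-a of the pub-hodgecm stage-1 cell) through the already-proved assembly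
`folland_4_37_of` (row B07-3 of the pub-hodgecm2 literature fan-out; file 4 of 4 after `ArchSiegelGaussianAction`,
`ArchGaussianOrbit`, `ArchGaussianFourier`).

THE ARGUMENT (Schrödinger-model «Gaussian orbit»: Folland's §4.5 Thm. (4.65) `μ(𝒜^{*-1})γ_Z = m(𝒜,Z)γ_{α(𝒜)Z}`,
`m(𝒜,Z) = det^{-1/2}(CZ+D)` (4.61), read backwards into §4.2).  Call `x ∈ Mp^𝓢(W)` over `g ∈ Sp(W)`
*Gaussian-covariant* (`MpS.IsGaussCovariant`) when for every `τ` in the Siegel half-space `𝔥_σ`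
  `x · e^{πi ᵗyτy} = m(τ) · e^{πi ᵗy(g⋆τ)y}`  with  `m(τ)² · j(g,τ) = 1`,
`g ⋆ τ = (𝐃τ−𝐂)(𝐀−𝐁τ)⁻¹ = α(ᵗg⁻¹)τ`, `j(g,τ) = det(𝐀−𝐁τ) = m(ᵗg⁻¹,τ)⁻²` (file 1) — i.e. (4.66) for `𝒜 = ᵗg⁻¹` with the
SQUARED multiplier.  Then:
* §1 Gaussian-covariant elements form a SUBGROUP containing `±1` (cocycle `j(gh,τ) = j(g,h⋆τ)j(h,τ)` and `(gh)⋆τ = g⋆(h⋆τ)`);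
* §2 each generator of `Mp^𝓢(W)` is Gaussian-covariant after a phase: the chirps `n(b)` as they stand (`m = 1`, `j = 1`),
  the Levi dilations `m(a, ᵗa⁻¹)` up to `1` or `i` (`m² j = det a/|det a|`), the Fourier transform `μ(i·1)` up to an
  eighth root of unity (`m² j = iⁿ`, from `𝓕 e^{πi xτx} = m e^{−πi ξτ⁻¹ξ}`, `m² det(−iτ) = 1`, file 3); so by Folland
  Prop. (4.10) (`Sp.eq_top_of_levi_unipotent_weyl_mem`) EVERY `g ∈ Sp(W)` carries a Gaussian-covariant implementer;
* §3 Gaussian-covariant ⇒ metaplectic (`C² det P = 1`): `k₀ = 2^{n/4} e^{πi x(i1)x}`, so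
  `C = ⟪k₀, x k₀⟫ = 2^{n/4} m ⟪k₀, e^{πi x(g⋆i)x}⟫`, and `⟪k₀, e^{πi xτ'x}⟫² det(1 − iτ') = 2^{n/2}` (file 3) with
  `det(1 − i(g⋆i)) j(g,i) = 2ⁿ det P(g)` (file 1) give `C² det P = 2^{n}·m²j/2ⁿ = 1` — this is R1; conversely a
  metaplectic element is `±` a Gaussian-covariant one over the same `g` (fibre theorem), hence Gaussian-covariant, so
  metaplectic elements are closed under composition — this is R2 (Folland's (4.37)(c), with the cocycle carried by
  `j(g,τ)` on `𝔥_σ` instead of the Fock-model block `P₁P₂ + Q₁Q̄₂`);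
* §4 `folland1989_Thm_4_37_ab_holds`, `folland1989_Thm_4_37_c_holds`, `folland1989_metaplectic_doubleValued_holds`.

## References

* [Folland1989] G. B. Folland, *Harmonic Analysis in Phase Space*, Princeton UP 1989 (held text
  `book:folland1989-harmonic-analysis-phase-space`): §4.2 Thm. (4.37) with (4.36)–(4.38) and Prop. (4.10), (4.27),
  (4.39); §4.5 (4.60)–(4.63), Thm. (4.64), Thm. (4.65)/(4.66) (chunks p0176–p0178); App. A Thm. 1 (chunk p0225).
* [DerezinskiGerard2022] J. Dereziński, C. Gérard, *Mathematics of Quantization and Quantum Fields*, CUP, §11.3.4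
  Thm. 11.38, Lemma 11.39 (the same vacuum-expectation argument).
-/

set_option autoImplicit false

noncomputable section

open Complex Matrix MeasureTheory SchwartzMap
open scoped ComplexOrder ComplexConjugate Real InnerProductSpace

namespace Literature.NumberTheory.Weil1964

open Literature.Analysis.SegalBargmann Literature.RepresentationTheory.HeisenbergGroup
  Literature.Analysis.SpecialFunctions

variable {σ : Type*} [Fintype σ] [DecidableEq σ]

namespace MpS

/-! ## 1. Gaussian-covariant implementers: a subgroup of `Mp^𝓢(W)` containing `±1` -/

/-- **Gaussian covariance with Folland's normalisation.**  `x ∈ Mp^𝓢(W)` over `g` is *Gaussian-covariant* when it maps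
every Gaussian `e^{πi ᵗyτy}`, `τ ∈ 𝔥_σ`, to `m(τ) e^{πi ᵗy(g⋆τ)y}` with `m(τ)² · j(g,τ) = 1` — the Schrödinger-model form of
Folland's Thm. (4.65)/(4.66) `μ(𝒜^{*-1})γ_Z = m(𝒜,Z)γ_{α(𝒜)Z}` with the multiplier (4.61) squared, which also encodes the
choice of phase `C_𝒜 = det^{-1/2}P` of (4.36)–(4.38). [cite: Folland1989, §4.5 Thm. (4.65), (4.61); §4.2 (4.36)–(4.38)] -/
def IsGaussCovariant (x : MpS σ) : Prop :=
  ∀ τ : Matrix σ σ ℂ, τ ∈ siegelH σ →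
    ∃ m : ℂ, x.1.2 (gaussS τ) = m • gaussS (Sp.sact (proj x) τ) ∧ m ^ 2 * Sp.sJ (proj x) τ = 1

/-- The same with an arbitrary constant `κ` in place of `1` (an implementer with the WRONG phase: `m(τ)² j(g,τ) = κ`).
[cite: Folland1989, §4.5 Thm. (4.65), (4.61)] -/
def IsGaussCovariantUpTo (x : MpS σ) (κ : ℂ) : Prop :=
  ∀ τ : Matrix σ σ ℂ, τ ∈ siegelH σ →
    ∃ m : ℂ, x.1.2 (gaussS τ) = m • gaussS (Sp.sact (proj x) τ) ∧ m ^ 2 * Sp.sJ (proj x) τ = κ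

/-- `1` is Gaussian-covariant. [cite: Folland1989, §4.5 Thm. (4.65)] -/
theorem isGaussCovariant_one : IsGaussCovariant (1 : MpS σ) := by
  intro τ hτ
  refine ⟨1, ?_, ?_⟩
  · rw [map_one, (Sp.sact_one τ).1, one_smul]; rfl
  · rw [map_one, (Sp.sact_one τ).2, one_pow, one_mul]

/-- **Products of Gaussian-covariant elements are Gaussian-covariant** (the cocycle `j(gh,τ) = j(g,h⋆τ) j(h,τ)`,
Folland (4.62), exactly as in the first lines of the proof of Thm. (4.65)). [cite: Folland1989, §4.5 (4.62), Thm. (4.65); Thm. (4.37)(c)] -/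
theorem IsGaussCovariant.mul {x y : MpS σ} (hx : IsGaussCovariant x) (hy : IsGaussCovariant y) :
    IsGaussCovariant (x * y) := by
  intro τ hτ
  obtain ⟨m₂, hy₁, hy₂⟩ := hy τ hτ
  obtain ⟨m₁, hx₁, hx₂⟩ := hx (Sp.sact (proj y) τ) (Sp.sact_mem _ hτ)
  refine ⟨m₂ * m₁, ?_, ?_⟩
  · rw [mul_apply, hy₁, map_smul, hx₁, smul_smul, map_mul, Sp.sact_mul _ _ hτ]
  · rw [map_mul, Sp.sJ_mul _ _ hτ]
    calc (m₂ * m₁) ^ 2 * (Sp.sJ (proj x) (Sp.sact (proj y) τ) * Sp.sJ (proj y) τ)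
        = (m₁ ^ 2 * Sp.sJ (proj x) (Sp.sact (proj y) τ)) * (m₂ ^ 2 * Sp.sJ (proj y) τ) := by ring
      _ = 1 := by rw [hx₂, hy₂, one_mul]

/-- **Inverses of Gaussian-covariant elements are Gaussian-covariant** (Folland (4.63)). [cite: Folland1989, §4.5 (4.63), Thm. (4.65)] -/
theorem IsGaussCovariant.inv {x : MpS σ} (hx : IsGaussCovariant x) : IsGaussCovariant x⁻¹ := by
  intro τ hτ
  have hτ₁ := Sp.sact_mem (proj x⁻¹) hτ
  obtain ⟨m, h1, h2⟩ := hx _ hτ₁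
  have hback : Sp.sact (proj x) (Sp.sact (proj x⁻¹) τ) = τ := by
    rw [← Sp.sact_mul _ _ hτ, ← map_mul, mul_inv_cancel, map_one, (Sp.sact_one τ).1]
  rw [hback] at h1
  have hm : m ≠ 0 := by
    rintro rfl
    rw [zero_pow two_ne_zero, zero_mul] at h2
    exact zero_ne_one h2
  have hcoc : Sp.sJ (proj x) (Sp.sact (proj x⁻¹) τ) * Sp.sJ (proj x⁻¹) τ = 1 := by
    rw [← Sp.sJ_mul _ _ hτ, ← map_mul, mul_inv_cancel, map_one, (Sp.sact_one τ).2]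
  refine ⟨m⁻¹, ?_, ?_⟩
  · have hxx : (x⁻¹).1.2 (x.1.2 (gaussS (Sp.sact (proj x⁻¹) τ))) = gaussS (Sp.sact (proj x⁻¹) τ) := by
      rw [← mul_apply, inv_mul_cancel]; rfl
    rw [h1, map_smul] at hxx
    calc (x⁻¹).1.2 (gaussS τ) = m⁻¹ • (m • (x⁻¹).1.2 (gaussS τ)) := by rw [smul_smul, inv_mul_cancel₀ hm, one_smul]
      _ = m⁻¹ • gaussS (Sp.sact (proj x⁻¹) τ) := by rw [hxx]
  · calc m⁻¹ ^ 2 * Sp.sJ (proj x⁻¹) τ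
        = m⁻¹ ^ 2 * Sp.sJ (proj x⁻¹) τ * (m ^ 2 * Sp.sJ (proj x) (Sp.sact (proj x⁻¹) τ)) := by rw [h2, mul_one]
      _ = (m⁻¹ * m) ^ 2 * (Sp.sJ (proj x) (Sp.sact (proj x⁻¹) τ) * Sp.sJ (proj x⁻¹) τ) := by ring
      _ = 1 := by rw [inv_mul_cancel₀ hm, one_pow, one_mul, hcoc]

/-- `−x` is Gaussian-covariant with `x` (`m ↦ −m`). [cite: Folland1989, Thm. (4.37)] -/
theorem IsGaussCovariant.negOne_mul {x : MpS σ} (hx : IsGaussCovariant x) : IsGaussCovariant (negOne * x) := by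
  intro τ hτ
  obtain ⟨m, h1, h2⟩ := hx τ hτ
  refine ⟨-m, ?_, ?_⟩
  · rw [mul_apply, negOne_apply, h1, map_mul, proj_negOne, one_mul, neg_smul]
  · rw [map_mul, proj_negOne, one_mul, neg_sq, h2]

/-- **Phase correction**: if `x` is Gaussian-covariant up to the constant `κ` and `c` is a unimodular square root of `κ⁻¹`,
then `c · x` is Gaussian-covariant. [cite: Folland1989, §4.2 (4.36)–(4.38)] -/
theorem IsGaussCovariantUpTo.unitScalar_mul {x : MpS σ} {κ c : ℂ} (hx : IsGaussCovariantUpTo x κ) (hc : ‖c‖ = 1)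
    (hcκ : c ^ 2 * κ = 1) : IsGaussCovariant (unitScalar c hc * x) := by
  intro τ hτ
  obtain ⟨m, h1, h2⟩ := hx τ hτ
  refine ⟨c * m, ?_, ?_⟩
  · rw [mul_apply, unitScalar_apply, h1, smul_smul, map_mul, proj_unitScalar, one_mul]
  · rw [map_mul, proj_unitScalar, one_mul, mul_pow, mul_assoc, h2, hcκ]

/-! ## 2. The generators are Gaussian-covariant (after a phase) -/

/-- **Chirps**: `n(b)` with the chirp `e^{−πi x·bx}` is Gaussian-covariant as it stands (`m = 1`, `j = 1`).
[cite: Folland1989, §4.2 (4.25), §4.5 Thm. (4.65) (proof)] -/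
theorem isGaussCovariant_unip (b : (σ → ℝ) →ₗ[ℝ] (σ → ℝ)) (hb : ∀ x x', dotPairing σ x (b x') = dotPairing σ x' (b x)) :
    IsGaussCovariant (unip b hb) := by
  intro τ hτ
  refine ⟨1, ?_, ?_⟩
  · rw [one_smul, proj_unip, ← chirpS_gaussS_eq_sact hτ b hb]; rfl
  · rw [proj_unip, (Sp.sact_unipotentSp b hb τ).2.2.2, one_pow, one_mul]

/-- **Levi dilations**: `m(a, ᵗa⁻¹)` with `|det a|^{-1/2} f ∘ a⁻¹` is Gaussian-covariant up to the sign of `det a`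
(`m² j = |det a|⁻¹ det a`). [cite: Folland1989, §4.2 (4.24), §4.5 Thm. (4.65) (proof)] -/
theorem isGaussCovariantUpTo_levi (a d : (σ → ℝ) ≃ₗ[ℝ] (σ → ℝ)) (had : ∀ x y, dotPairing σ (a x) (d y) = dotPairing σ x y) :
    IsGaussCovariantUpTo (levi a d had)
      ((LinearMap.det (a : (σ → ℝ) →ₗ[ℝ] (σ → ℝ)) / |LinearMap.det (a : (σ → ℝ) →ₗ[ℝ] (σ → ℝ))| : ℝ) : ℂ) := by
  intro τ hτ
  refine ⟨leviFactor a, ?_, ?_⟩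
  · rw [proj_levi, ← leviS_gaussS_eq_sact hτ a d had]; rfl
  · rw [proj_levi, (Sp.sact_leviSp a d had τ).2.2.2, leviFactor_sq_mul_det]

/-- **Over every Levi element there is a Gaussian-covariant implementer** (phase `1` if `det a > 0`, `i` if `det a < 0`).
[cite: Folland1989, §4.2 (4.24), (4.36)–(4.38)] -/
theorem exists_isGaussCovariant_levi (a d : (σ → ℝ) ≃ₗ[ℝ] (σ → ℝ))
    (had : ∀ x y, dotPairing σ (a x) (d y) = dotPairing σ x y) :
    ∃ x : MpS σ, proj x = leviSp (dotPairing σ) a d had ∧ IsGaussCovariant x := by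
  set δ : ℝ := LinearMap.det (a : (σ → ℝ) →ₗ[ℝ] (σ → ℝ)) with hδ
  have hδ0 : δ ≠ 0 := (LinearEquiv.isUnit_det' a).ne_zero
  by_cases hpos : 0 < δ
  · refine ⟨unitScalar 1 (by rw [norm_one]) * levi a d had, by rw [map_mul, proj_unitScalar, one_mul, proj_levi], ?_⟩
    refine (isGaussCovariantUpTo_levi a d had).unitScalar_mul _ ?_
    rw [← hδ, abs_of_pos hpos, div_self hδ0, Complex.ofReal_one, one_pow, one_mul]
  · have hneg : δ < 0 := lt_of_le_of_ne (not_lt.1 hpos) hδ0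
    refine ⟨unitScalar I (by rw [Complex.norm_I]) * levi a d had,
      by rw [map_mul, proj_unitScalar, one_mul, proj_levi], ?_⟩
    refine (isGaussCovariantUpTo_levi a d had).unitScalar_mul _ ?_
    rw [← hδ, abs_of_neg hneg, div_neg, div_self hδ0, Complex.ofReal_neg, Complex.ofReal_one, I_sq, neg_mul_neg, one_mul]

/-- **The Fourier transform** `μ(i·1)` (the tree's `fourierPi` = Mathlib's `𝓕`, over the Weyl element `(p,q) ↦ (−q,p)`) is
Gaussian-covariant up to `iⁿ`: `𝓕 e^{πi xτx} = m e^{−πi ξτ⁻¹ξ}` with `m² det(−iτ) = 1`, and `j = det τ`.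
[cite: Folland1989, §4.5 Thm. (4.65) (proof, case 𝒥); Prop. (4.39)] -/
theorem isGaussCovariantUpTo_fourier :
    IsGaussCovariantUpTo (unitary (diagHom fun _ : σ => Circle.exp (π / 2))) (I ^ Fintype.card σ) := by
  intro τ hτ
  obtain ⟨m, hm, hF⟩ := fourierPi_gaussS hτ
  refine ⟨m, ?_, ?_⟩
  · rw [(Sp.sact_weyl _ coe_proj_unitary_I τ).2.2.1, ← hF,
      show (unitary (diagHom fun _ : σ => Circle.exp (π / 2))).1.2 (gaussS τ) =
        unitaryEquivPi (diagHom fun _ : σ => Circle.exp (π / 2)) (gaussS τ) from rfl,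
      unitaryEquivPi_apply, ← fourierPi_eq_unitaryOpPi]
  · rw [(Sp.sact_weyl _ coe_proj_unitary_I τ).2.2.2]
    rw [Matrix.det_smul] at hm
    -- `m² (−i)ⁿ det τ = 1 ⇒ m² det τ = iⁿ`
    have hI : (-I) ^ Fintype.card σ * I ^ Fintype.card σ = 1 := by
      rw [← mul_pow, neg_mul, I_mul_I, neg_neg, one_pow]
    calc m ^ 2 * τ.det = m ^ 2 * τ.det * ((-I) ^ Fintype.card σ * I ^ Fintype.card σ) := by rw [hI, mul_one]
      _ = (m ^ 2 * ((-I) ^ Fintype.card σ * τ.det)) * I ^ Fintype.card σ := by ring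
      _ = I ^ Fintype.card σ := by rw [hm, one_mul]

/-- **Over the Weyl element there is a Gaussian-covariant implementer** (`e^{−iπn/4} · 𝓕`, Folland's «eighth root of unity»
after Prop. (4.39)). [cite: Folland1989, §4.2 Prop. (4.39), (4.26)] -/
theorem exists_isGaussCovariant_weyl :
    ∃ x : MpS σ, proj x = realifySp σ (diagHom fun _ : σ => Circle.exp (π / 2)) ∧ IsGaussCovariant x := by
  set ζ : ℂ := cexp ((((-(π / 4)) : ℝ) : ℂ) * I) with hζ
  have hζn : ‖ζ‖ = 1 := by rw [hζ, Complex.norm_exp_ofReal_mul_I]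
  have hζ2 : ζ ^ 2 = -I := by
    rw [hζ, ← Complex.exp_nat_mul]
    have : ((2 : ℕ) : ℂ) * ((((-(π / 4)) : ℝ) : ℂ) * I) = -(π / 2 * I) := by push_cast; ring
    rw [this, Complex.exp_neg, Complex.exp_pi_div_two_mul_I, Complex.inv_I]
  have hc : ‖ζ ^ Fintype.card σ‖ = 1 := by rw [norm_pow, hζn, one_pow]
  refine ⟨unitScalar (ζ ^ Fintype.card σ) hc * unitary (diagHom fun _ : σ => Circle.exp (π / 2)),
    by rw [map_mul, proj_unitScalar, one_mul, proj_unitary], ?_⟩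
  refine isGaussCovariantUpTo_fourier.unitScalar_mul hc ?_
  rw [← pow_mul, mul_comm (Fintype.card σ) 2, pow_mul, hζ2, ← mul_pow, neg_mul, I_mul_I, neg_neg, one_pow]

/-- **Every `g ∈ Sp(W)` carries a Gaussian-covariant implementer** (Gaussian-covariant elements lie over a subgroup
containing the Levi elements, the unipotents and the Weyl element, hence over everything by Folland Prop. (4.10)).
[cite: Folland1989, §4.1 Prop. (4.10); §4.5 Thm. (4.65)] -/
theorem exists_isGaussCovariant (g : symplecticGroup (polar (dotPairing σ))) : ∃ x : MpS σ, proj x = g ∧ IsGaussCovariant x := by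
  let L : Subgroup (symplecticGroup (polar (dotPairing σ))) :=
    { carrier := {g | ∃ x : MpS σ, proj x = g ∧ IsGaussCovariant x}
      mul_mem' := by
        rintro g h ⟨x, rfl, hx⟩ ⟨y, rfl, hy⟩
        exact ⟨x * y, map_mul _ _ _, hx.mul hy⟩
      one_mem' := ⟨1, map_one _, isGaussCovariant_one⟩
      inv_mem' := by
        rintro g ⟨x, rfl, hx⟩
        exact ⟨x⁻¹, map_inv _ _, hx.inv⟩ }
  have hL : L = ⊤ :=
    Sp.eq_top_of_levi_unipotent_weyl_mem (L := L) (fun a d had => exists_isGaussCovariant_levi a d had)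
      (fun b hb => ⟨unip b hb, proj_unip b hb, isGaussCovariant_unip b hb⟩)
      ⟨_, exists_isGaussCovariant_weyl, fun p q => by
        have h := coe_proj_unitary_I (σ := σ) p q
        rwa [proj_unitary] at h⟩
  have hg : g ∈ L := by rw [hL]; exact Subgroup.mem_top g
  exact hg

/-! ## 3. Gaussian-covariant ⟺ metaplectic -/

omit [DecidableEq σ] in
/-- `(2^{n/4})⁴ = 2ⁿ`. [cite: Folland1989, §1.7] -/
private theorem vacCoef_pow_four : ((vacCoef σ : ℝ) : ℂ) ^ 4 = 2 ^ Fintype.card σ := by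
  have h : (vacCoef σ) ^ 4 = (2 : ℝ) ^ Fintype.card σ := by
    rw [vacCoef, ← Real.rpow_natCast, ← Real.rpow_mul zero_le_two, ← Real.rpow_natCast]
    congr 1
    push_cast
    ring
  have h' := congrArg (fun r : ℝ => (r : ℂ)) h
  push_cast at h'
  exact h'

/-- **Gaussian-covariant ⇒ metaplectic** (`C² det P = 1`): the vacuum is `2^{n/4} e^{πi x(i1)x}`, so
`C(x) = 2^{n/4} m ⟪h₀, e^{πi x(g⋆i)x}⟫`; with `⟪h₀, e^{πi xτ'x}⟫² det(1 − iτ') = 2^{n/2}` and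
`det(1 − i(g⋆i)) j(g,i) = 2ⁿ det P(g)` this is `C² det P = 1` — Folland's `C_𝒜 = K_𝒜(0,0) = det^{-1/2} P`.
[cite: Folland1989, §4.2 (4.36)–(4.38), Thm. (4.37)(a)(b)] -/
theorem IsGaussCovariant.isMetaplectic {x : MpS σ} (hx : IsGaussCovariant x) : IsMetaplectic x := by
  obtain ⟨m, h1, h2⟩ := hx (I • 1) I_smul_one_mem_siegelH
  have hτ' := Sp.sact_mem (proj x) (I_smul_one_mem_siegelH (σ := σ))
  have hJ := inner_toL2_hermitePi_zero_gaussS_sq hτ'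
  have hP := Sp.det_one_sub_I_sact_mul_sJ (proj x)
  have hx0 : x.1.2 (hermitePi 0) = ((vacCoef σ : ℝ) : ℂ) • (m • gaussS (Sp.sact (proj x) (I • 1))) := by
    rw [hermitePi_zero_eq_smul_gaussS, map_smul, h1]
  have hvac : vac x = ((vacCoef σ : ℝ) : ℂ) * (m *
      ⟪toL2 (hermitePi (0 : σ →₀ ℕ)), toL2 (gaussS (Sp.sact (proj x) (I • 1)))⟫_ℂ) := by
    rw [vac_apply, ← toL2_hermitePi_zero, hx0, map_smul, map_smul, inner_smul_right, inner_smul_right]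
  have h2n : (2 : ℂ) ^ Fintype.card σ ≠ 0 := pow_ne_zero _ two_ne_zero
  rw [isMetaplectic_iff]
  apply mul_right_cancel₀ h2n
  calc vac x ^ 2 * (Sp.follandP (proj x)).det * 2 ^ Fintype.card σ
      = (((vacCoef σ : ℝ) : ℂ) * (m * ⟪toL2 (hermitePi (0 : σ →₀ ℕ)), toL2 (gaussS (Sp.sact (proj x) (I • 1)))⟫_ℂ)) ^ 2 *
          (2 ^ Fintype.card σ * (Sp.follandP (proj x)).det) := by rw [hvac]; ring
    _ = (((vacCoef σ : ℝ) : ℂ) * (m * ⟪toL2 (hermitePi (0 : σ →₀ ℕ)), toL2 (gaussS (Sp.sact (proj x) (I • 1)))⟫_ℂ)) ^ 2 *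
          ((1 - I • Sp.sact (proj x) (I • 1)).det * Sp.sJ (proj x) (I • 1)) := by rw [hP]
    _ = ((vacCoef σ : ℝ) : ℂ) ^ 2 * (m ^ 2 * Sp.sJ (proj x) (I • 1)) *
          (⟪toL2 (hermitePi (0 : σ →₀ ℕ)), toL2 (gaussS (Sp.sact (proj x) (I • 1)))⟫_ℂ ^ 2 *
            (1 - I • Sp.sact (proj x) (I • 1)).det) := by ring
    _ = ((vacCoef σ : ℝ) : ℂ) ^ 4 := by rw [h2, hJ]; ring
    _ = 1 * 2 ^ Fintype.card σ := by rw [vacCoef_pow_four, one_mul]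

/-- **Metaplectic ⇒ Gaussian-covariant**: a metaplectic `x` is `±` the Gaussian-covariant implementer over the same
`g` (fibre theorem `eq_or_eq_negOne_mul`). [cite: Folland1989, Thm. (4.37), p. 161] -/
theorem IsMetaplectic.isGaussCovariant {x : MpS σ} (hx : IsMetaplectic x) : IsGaussCovariant x := by
  obtain ⟨x', hx', hG⟩ := exists_isGaussCovariant (proj x)
  rcases hG.isMetaplectic.eq_or_eq_negOne_mul hx hx' with h | h
  · rw [h]; exact hG
  · rw [h]; exact hG.negOne_mul

/-- Gaussian covariance IS Folland's metaplectic normalisation. [cite: Folland1989, Thm. (4.37), §4.5 Thm. (4.65)] -/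
theorem isGaussCovariant_iff_isMetaplectic (x : MpS σ) : IsGaussCovariant x ↔ IsMetaplectic x :=
  ⟨IsGaussCovariant.isMetaplectic, IsMetaplectic.isGaussCovariant⟩

end MpS

/-! ## 4. The records R1, R2 and the target N-W∞-a, discharged -/

variable (σ) in
/-- **R1 PROVED — Folland Thm. (4.37)(a)(b) with the normalisation `C_𝒜 = det^{-1/2}P`**: over every `g ∈ Sp(W)` there is
a metaplectic-normalised element of `Mp^𝓢(W)`. [cite: Folland1989, §4.2 Thm. (4.37)(a)(b), (4.36)–(4.38)] -/
theorem folland1989_Thm_4_37_ab_holds : Folland1989_Thm_4_37_ab σ := fun g => by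
  obtain ⟨x, hx, hG⟩ := MpS.exists_isGaussCovariant g
  exact ⟨x, hx, hG.isMetaplectic⟩

variable (σ) in
/-- `Folland1989_Thm_4_37_ab` — `_holds` alias of `folland1989_Thm_4_37_ab_holds` above under the fact's exact name (appended
2026-08-28, D-0026 bookkeeping: the proof term is the existing theorem of this file; no statement,
definition or attribute is edited; no new named fact; the ledger's debt table listed the fact
unproved). [cite: Folland1989, §4.2 Thm. (4.37)(a)(b), (4.36)–(4.38)] -/
theorem _root_.Literature.NumberTheory.Weil1964.Folland1989_Thm_4_37_ab_holds :
    Folland1989_Thm_4_37_ab σ :=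
  _root_.Literature.NumberTheory.Weil1964.folland1989_Thm_4_37_ab_holds (σ := σ)

variable (σ) in
/-- **R2 PROVED — Folland Thm. (4.37)(c), squared form**: metaplectic-normalised elements are closed under composition.
[cite: Folland1989, §4.2 Thm. (4.37)(c), pp. 160–161] -/
theorem folland1989_Thm_4_37_c_holds : Folland1989_Thm_4_37_c σ := fun _ _ hx hy =>
  (hx.isGaussCovariant.mul hy.isGaussCovariant).isMetaplectic

variable (σ) in
/-- `Folland1989_Thm_4_37_c` — `_holds` alias of `folland1989_Thm_4_37_c_holds` above under the fact's exact name (appended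
2026-08-28, D-0026 bookkeeping: the proof term is the existing theorem of this file; no statement,
definition or attribute is edited; no new named fact; the ledger's debt table listed the fact
unproved). [cite: Folland1989, §4.2 Thm. (4.37)(c), pp. 160–161] -/
theorem _root_.Literature.NumberTheory.Weil1964.Folland1989_Thm_4_37_c_holds :
    Folland1989_Thm_4_37_c σ :=
  _root_.Literature.NumberTheory.Weil1964.folland1989_Thm_4_37_c_holds (σ := σ)

variable (σ) in
/-- **N-W∞-a PROVED — the metaplectic representation of `Sp(W)` exists and is unique as a double-valued unitary
representation normalising the Schrödinger representation** (`folland_4_37_of` applied to R1, R2).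
[cite: Folland1989, §4.2 Thm. (4.37), p. 156, Prop. (4.40)] -/
theorem folland1989_metaplectic_doubleValued_holds : Folland1989_metaplectic_doubleValued σ :=
  folland_4_37_of (folland1989_Thm_4_37_ab_holds σ) (folland1989_Thm_4_37_c_holds σ)

omit [DecidableEq σ] in
variable (σ) in
/-- `Folland1989_metaplectic_doubleValued` — exact-name discharge for EVERY `σ` (the def carries only `[Fintype σ]`;
the prover `folland1989_metaplectic_doubleValued_holds` above also asks for `[DecidableEq σ]`, supplied here
classically). Appended 2026-08-28, D-0026 bookkeeping: no statement, definition or attribute is edited; no new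
named fact. [cite: Folland1989, §4.2 Thm. (4.37), p. 156, Prop. (4.40)] -/
theorem _root_.Literature.NumberTheory.Weil1964.Folland1989_metaplectic_doubleValued_holds :
    Folland1989_metaplectic_doubleValued σ := by
  classical
  exact folland1989_metaplectic_doubleValued_holds σ

end Literature.NumberTheory.Weil1964
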